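import Summits.CriticalPhenomena.PercolationContinuityZ3.Theorems.PercNearOneGluingNoHeavyQuantChiFNonIntegrable
import HarnessLib

/-!
# Gronwall form of the Aizenman–Barsky inequality (5.51): `∫_q^p χ^f(r) dr ≥ ((1-p)/(2d)) · log(θ(p)/θ(q))`, and the explicit
# divergence of the integrated finite-cluster susceptibility at `p_c⁺` — quant lane, METHOD = differential inequalities near `p_c`, seat p4 gen 6

builds on p205010 (kernel theorem, internal audit signed; external expert review pending).
Status sentence for p205010: "θ(p_c) = 0 on ℤ^d, all d ≥ 2 — kernel-verified (Lean 4/Mathlib, standard axioms); internal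
adversarial audit SIGNED 2026-08-20 04:29Z; external expert review pending."

Seat `prim-quant-p4`, `--supports stmt-CriticalPhenomena-4575`; pure proofs, no definitions.  Notation as in `…QuantMagnetizationGrowth`
(`M(p,γ) = 1 - Z_p(1-γ)`, `χ(p,γ)`, `χ^f = meanClusterSize`, real parameters via `GhostField.prm`).

* `ChiF.log_magnetization_sub_le` — at fixed `γ ∈ (0,1)`: `log M(p,γ) - log M(q,γ) ≤ (2d/(1-p)) ∫_q^p χ(r,γ) dr` (`0 < q ≤ p < 1`):
  `ChiF.magnetization_sub_le_mul_integral` on each piece of a uniform partition of `[q,p]` (`M(t_i) ≥ M(t_{i+1})(1 - K I_i)`),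
  `log(1-x) ≥ -x/(1-x)`, telescoping, mesh `→ 0` — a discrete Gronwall argument (no differentiability of `M` in `p` is used).
* **`ChiF.lintegral_chiF_ge_log`** — `γ ↓ 0`: **`∫_q^p χ^f(r) dr ≥ ((1-p)/(2d)) · log(θ(p)/θ(q))`** for `0 < q ≤ p < 1`, `θ(q) > 0` (left side
  a lower Lebesgue integral): the growth of `log θ` over `[q,p]` is paid for by the integrated finite-cluster susceptibility;
  equivalently `ChiF.theta_le_theta_mul_exp_lintegral`: `θ(p) ≤ θ(q) · exp((2d/(1-p)) ∫_q^p χ^f)` (an UPPER bound on the growth of `θ`,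
  the two-sided companion of the mean-field lower bound `θ(p) ≥ p - p_c`).
* **`ChiF.lintegral_chiF_ge_log_of_thetaModulusNearCritical`** — with the mean-field bound `θ(p) ≥ p - p_c` and a (T2) modulus
  `θ(q) ≤ ω(q - p_c)`: `∫_q^p χ^f ≥ ((1-p)/(2d)) log((p - p_c)/ω(q - p_c)) → ∞` as `q ↓ p_c`, explicitly (with the lane's modulus:
  iterated-logarithm class, an explicit function and nothing more); **`ChiF.lintegral_chiF_ge_log_of_triangle`** — under
  `TriangleCondition d`: `∫_q^p χ^f ≥ ((1-p)/(2d)) log((p - p_c)/(C(q - p_c)))`, the logarithmic divergence that `γ' = 1` predicts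
  (one-sided).

HONEST STATUS: bookkeeping on the printed inequality (5.51) (Grimmett 1999; Aizenman–Barsky 1987 (1.13)) plus `θ(p_c) = 0` (p205010);
we found no printed statement of these integrated bounds (nearest: Newman 1987, `γ' ≥ 2(1-1/δ)` conditional on exponents; Aizenman–Barsky
§6 reads (1.13) as a bound on the level curves of `M`).  Not an exponent, not two-sided.

## References
* G. Grimmett, *Percolation*, 2nd ed. (1999), §5.3 Lemma (5.51) [GrimmettPercolation1999].
* M. Aizenman, D. J. Barsky, Comm. Math. Phys. 108 (1987) 489–526: (1.13), §6 [AizenmanBarsky1987].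
* C. M. Newman, J. Stat. Phys. 47 (1987) 695–699 [Newman1987BetaDelta].
-/

noncomputable section

namespace Summit.CriticalPhenomena.PercolationContinuityZ3.Theorems

open MeasureTheory Set Filter Topology Literature.Probability.Percolation Literature.Probability.LatticeModels
open scoped Classical ENNReal

namespace ChiF

/-! ### §12. Gronwall form: `∫_q^p χ^f(r) dr ≥ ((1-p)/(2d)) · log(θ(p)/θ(q))` -/

section Gronwall

variable {d : ℕ}

/-- `M(p,γ) ≥ γ` (`γ ∈ [0,1]`): the cluster contains its root, so `1 - (1-γ)^{|C|} ≥ γ`. -/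
theorem gamma_le_one_sub_clusterGF (p : unitInterval) {γ : ℝ} (hγ0 : 0 ≤ γ) (hγ1 : γ ≤ 1) :
    γ ≤ 1 - clusterGF (zdGraph d) (0 : Site d) p (1 - γ) := by
  rw [← integral_magFn_eq p hγ0 hγ1]
  have hconst : ∫ _ω, γ ∂(bondPercolation (zdGraph d) p) = γ := by simp
  have h : ∫ _ω, γ ∂(bondPercolation (zdGraph d) p) ≤
      ∫ ω, (if (openCluster ω 0).Finite then 1 - (1 - γ) ^ (openCluster ω 0).ncard else 1) ∂(bondPercolation (zdGraph d) p) := by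
    refine integral_mono_of_nonneg (Eventually.of_forall fun ω => hγ0) (integrable_clusterFn (zdGraph d) (0 : Site d) p
      (abs_one_sub_pow_le hγ0 hγ1) 1) (Eventually.of_forall fun ω => ?_)
    simp only
    split_ifs with hfin
    · have hne : (openCluster ω (0 : Site d)).ncard ≠ 0 := by
        rw [Ne, Set.ncard_eq_zero hfin]; exact Set.nonempty_iff_ne_empty.1 ⟨0, mem_openCluster_self ω 0⟩
      obtain ⟨k, hk⟩ := Nat.exists_eq_succ_of_ne_zero hne
      rw [hk, pow_succ]
      have h1 : (1 - γ) ^ k ≤ 1 := pow_le_one₀ (by linarith) (by linarith)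
      have h2 : 0 ≤ (1 - γ) ^ k := pow_nonneg (by linarith) _
      nlinarith
    · exact hγ1
  rwa [hconst] at h

/-- `log(1 - x) ≥ -x/(1 - x)` for `x < 1`. -/
theorem neg_div_le_log_one_sub {x : ℝ} (hx1 : x < 1) : -(x / (1 - x)) ≤ Real.log (1 - x) := by
  have h1x : 0 < 1 - x := by linarith
  have h := Real.log_le_sub_one_of_pos (inv_pos.2 h1x)
  rw [Real.log_inv] at h
  have h2 : (1 - x)⁻¹ - 1 = x / (1 - x) := by field_simp; ring
  linarith [h2]

/-- **Gronwall form of Lemma (5.51) at fixed `γ`**: for `0 < γ < 1`, `0 < q ≤ p < 1`, with `M(r) = M(r,γ) = 1 - Z_r(1-γ)`: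
`log M(p) - log M(q) ≤ (2d/(1-p)) ∫_q^p χ(r,γ) dr` (`magnetization_sub_le_mul_integral` on each piece of a fine uniform partition of
`[q,p]`, `log(1-x) ≥ -x/(1-x)`, telescoping, mesh `→ 0`). -/
theorem log_magnetization_sub_le (γ : unitInterval) (hγ0 : 0 < (γ : ℝ)) (hγ1 : (γ : ℝ) < 1) {q p : ℝ}
    (hq : 0 < q) (hqp : q ≤ p) (hp : p < 1) :
    Real.log (1 - clusterGF (zdGraph d) (0 : Site d) (GhostField.prm p) (1 - γ)) -
        Real.log (1 - clusterGF (zdGraph d) (0 : Site d) (GhostField.prm q) (1 - γ)) ≤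
      (2 * d / (1 - p)) * ∫ r in q..p, ∑' S : Finset (Site d), ((S.card : ℝ) * (1 - (γ : ℝ)) ^ S.card) *
          (bondPercolation (zdGraph d) (GhostField.prm r)).real (clusterIs 0 S) := by
  set K : ℝ := 2 * d / (1 - p) with hK
  have hK0 : 0 ≤ K := div_nonneg (by positivity) (by linarith)
  set M : ℝ → ℝ := fun r => 1 - clusterGF (zdGraph d) (0 : Site d) (GhostField.prm r) (1 - γ) with hM
  set χ : ℝ → ℝ := fun r => ∑' S : Finset (Site d), ((S.card : ℝ) * (1 - (γ : ℝ)) ^ S.card) *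
    (bondPercolation (zdGraph d) (GhostField.prm r)).real (clusterIs 0 S) with hχ
  obtain ⟨hχmeas, hχbd⟩ := measurable_chiGamma (d := d) γ hγ0 hγ1.le
  have hMpos : ∀ r, 0 < M r := fun r => hγ0.trans_le (gamma_le_one_sub_clusterGF (GhostField.prm r) hγ0.le hγ1.le)
  have hχint : ∀ a b : ℝ, IntervalIntegrable χ volume a b := by
    intro a b
    refine ⟨?_, ?_⟩ <;>
      exact Integrable.of_bound hχmeas.aestronglyMeasurable (1 / (γ : ℝ))
        (Eventually.of_forall fun r => by rw [Real.norm_eq_abs, abs_of_nonneg (hχbd r).1]; exact (hχbd r).2)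
  set I : ℝ := ∫ r in q..p, χ r with hI
  have hI0 : 0 ≤ I := intervalIntegral.integral_nonneg hqp fun r _ => (hχbd r).1
  -- the bound for each fine partition
  have hN : ∀ N : ℕ, 1 ≤ N → K * (p - q) / ((γ : ℝ) * N) ≤ 1 / 2 →
      Real.log (M p) - Real.log (M q) ≤ K / (1 - K * (p - q) / ((γ : ℝ) * N)) * I := by
    intro N hN1 hδ
    set h : ℝ := (p - q) / N with hh
    set δ : ℝ := K * (p - q) / ((γ : ℝ) * N) with hδdef
    have hNpos : (0 : ℝ) < N := by exact_mod_cast hN1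
    have hh0 : 0 ≤ h := div_nonneg (by linarith) hNpos.le
    have hδ0 : 0 ≤ δ := by rw [hδdef]; positivity
    set t : ℕ → ℝ := fun i => q + i * h with ht
    have ht0 : t 0 = q := by simp [ht]
    have htN : t N = p := by
      simp only [ht, hh]; rw [mul_div_cancel₀ _ hNpos.ne']; ring
    have htmono : ∀ i, t i ≤ t (i + 1) := fun i => by
      simp only [ht]; push_cast; nlinarith
    have htq : ∀ i, q ≤ t i := fun i => by
      simp only [ht]; exact le_add_of_nonneg_right (mul_nonneg (Nat.cast_nonneg _) hh0)
    have htp : ∀ i, i ≤ N → t i ≤ p := fun i hi => by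
      have hi' : (i : ℝ) ≤ N := by exact_mod_cast hi
      have := mul_le_mul_of_nonneg_right hi' hh0
      rw [← htN]; simp only [ht]; linarith
    -- one step: `log M(t i) ≥ log M(t (i+1)) - (K/(1-δ)) ∫_{t i}^{t (i+1)} χ`
    have hstep : ∀ i, i < N → Real.log (M (t (i + 1))) - Real.log (M (t i)) ≤
        K / (1 - δ) * ∫ r in t i..t (i + 1), χ r := by
      intro i hi
      have hti1 : t (i + 1) < 1 := (htp (i + 1) hi).trans_lt hp
      have hS := magnetization_sub_le_mul_integral (d := d) γ hγ0 hγ1 (hq.trans_le (htq i)) (htmono i) hti1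
      set Ii : ℝ := ∫ r in t i..t (i + 1), χ r with hIi
      have hIi0 : 0 ≤ Ii := intervalIntegral.integral_nonneg (htmono i) fun r _ => (hχbd r).1
      have hIih : Ii ≤ h / (γ : ℝ) := by
        calc Ii ≤ ∫ r in t i..t (i + 1), (1 / (γ : ℝ)) :=
              intervalIntegral.integral_mono_on (htmono i) (hχint _ _) intervalIntegrable_const fun r _ => (hχbd r).2
          _ = h / (γ : ℝ) := by rw [intervalIntegral.integral_const]; simp [ht]; ring
      have hKi : 2 * d / (1 - t (i + 1)) ≤ K :=
        div_le_div_of_nonneg_left (by positivity) (by linarith) (by linarith [htp (i + 1) hi])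
      -- `x := K Ii ≤ δ ≤ 1/2`, `M(t i) ≥ M(t(i+1)) (1 - x)`
      set x : ℝ := K * Ii with hx
      have hx0 : 0 ≤ x := mul_nonneg hK0 hIi0
      have hxδ : x ≤ δ := by
        calc x ≤ K * (h / (γ : ℝ)) := mul_le_mul_of_nonneg_left hIih hK0
          _ = δ := by rw [hδdef, hh]; field_simp
      have hx1 : x < 1 := by linarith
      have hMM : M (t (i + 1)) * (1 - x) ≤ M (t i) := by
        have h1 : M (t (i + 1)) - M (t i) ≤ K * M (t (i + 1)) * Ii := by
          refine hS.trans ?_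
          exact mul_le_mul_of_nonneg_right (mul_le_mul_of_nonneg_right hKi (hMpos _).le) hIi0
        nlinarith
      -- take logs
      have hlog1 : Real.log (M (t (i + 1))) + Real.log (1 - x) ≤ Real.log (M (t i)) := by
        rw [← Real.log_mul (hMpos _).ne' (by linarith)]
        exact Real.log_le_log (mul_pos (hMpos _) (by linarith)) hMM
      have hlog2 : -(x / (1 - x)) ≤ Real.log (1 - x) := neg_div_le_log_one_sub hx1
      have hx3 : x / (1 - x) ≤ K / (1 - δ) * Ii := by
        calc x / (1 - x) ≤ x / (1 - δ) := div_le_div_of_nonneg_left hx0 (by linarith) (by linarith)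
          _ = K / (1 - δ) * Ii := by rw [hx]; ring
      linarith
    -- sum the steps
    have hsum := Finset.sum_le_sum fun i hi => hstep i (Finset.mem_range.1 hi)
    rw [Finset.sum_range_sub (fun i => Real.log (M (t i))) N, htN, ht0, ← Finset.mul_sum,
      intervalIntegral.sum_integral_adjacent_intervals (fun k _ => hχint _ _), ht0, htN] at hsum
    exact hsum
  -- let the mesh tend to zero
  have hlim : Tendsto (fun N : ℕ => K / (1 - K * (p - q) / ((γ : ℝ) * N)) * I) atTop (𝓝 (K / (1 - 0) * I)) := by
    have h1 : Tendsto (fun N : ℕ => K * (p - q) / ((γ : ℝ) * N)) atTop (𝓝 0) := by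
      have h := tendsto_const_div_atTop_nhds_zero_nat (K * (p - q) / (γ : ℝ))
      refine h.congr fun N => ?_
      rw [div_div]
    exact ((tendsto_const_nhds.div (tendsto_const_nhds.sub h1) (by norm_num)).mul_const I)
  rw [sub_zero, div_one] at hlim
  have hev : ∀ᶠ N : ℕ in atTop, Real.log (M p) - Real.log (M q) ≤ K / (1 - K * (p - q) / ((γ : ℝ) * N)) * I := by
    have h1 : Tendsto (fun N : ℕ => K * (p - q) / ((γ : ℝ) * N)) atTop (𝓝 0) := by
      have h := tendsto_const_div_atTop_nhds_zero_nat (K * (p - q) / (γ : ℝ))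
      refine h.congr fun N => ?_
      rw [div_div]
    filter_upwards [Filter.eventually_ge_atTop 1, h1 (Iic_mem_nhds (by norm_num : (0:ℝ) < 1 / 2))] with N hN1 hN2
    exact hN N hN1 hN2
  exact ge_of_tendsto hlim hev

/-- **`∫_q^p χ^f(r) dr ≥ ((1-p)/(2d)) · log(θ(p)/θ(q))`** for `0 < q ≤ p < 1` with `θ(q) > 0` (`d ≥ 1`; left side a lower Lebesgue
integral in `ℝ≥0∞`).  From `log_magnetization_sub_le` (`χ(·,γ) ≤ χ^f`, `M(p,γ) ≥ θ(p)`, `M(q,γ) → θ(q)` as `γ ↓ 0`).  The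
Aizenman–Barsky inequality (5.51) as an explicit LOWER bound on the integrated finite-cluster susceptibility in terms of the growth of
`θ`; with `θ(q) → 0` as `q ↓ p_c` (p205010) the right side tends to `∞` (sequel corollaries).  OURS (bookkeeping on a printed
inequality; no printed statement found). -/
theorem lintegral_chiF_ge_log (hd : 1 ≤ d) {q p : ℝ} (hq : 0 < q) (hqp : q ≤ p) (hp : p < 1)
    (hθq : 0 < theta (zdGraph d) 0 (GhostField.prm q)) :
    ENNReal.ofReal ((1 - p) / (2 * d) * Real.log (theta (zdGraph d) 0 (GhostField.prm p) / theta (zdGraph d) 0 (GhostField.prm q))) ≤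
      ∫⁻ r in Set.Ioc q p, meanClusterSize (zdGraph d) (0 : Site d) (GhostField.prm r) := by
  by_cases htop : ∫⁻ r in Set.Ioc q p, meanClusterSize (zdGraph d) (0 : Site d) (GhostField.prm r) = ⊤
  · rw [htop]; exact le_top
  set J := (∫⁻ r in Set.Ioc q p, meanClusterSize (zdGraph d) (0 : Site d) (GhostField.prm r)).toReal with hJ
  rw [← ENNReal.ofReal_toReal htop]
  refine ENNReal.ofReal_le_ofReal ?_
  have hd0 : (0 : ℝ) < d := by exact_mod_cast hd
  set K : ℝ := 2 * d / (1 - p) with hK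
  have hK0 : 0 < K := div_pos (by positivity) (by linarith)
  have hθp : 0 < theta (zdGraph d) 0 (GhostField.prm p) :=
    hθq.trans_le (theta_mono_holds (zdGraph d) 0 (Set.monotone_projIcc _ hqp))
  -- for every `γ_k = 1/(k+2)`: `M(q,γ_k) ≥ θ(p) · exp(-K J)`
  set γs : ℕ → unitInterval := fun k => ⟨1 / ((k : ℝ) + 2), by positivity, by
    rw [div_le_one (by positivity)]; linarith⟩ with hγs
  have hγ0 : ∀ k, 0 < ((γs k : unitInterval) : ℝ) := fun k => by simp only [hγs]; positivity
  have hγ1 : ∀ k, ((γs k : unitInterval) : ℝ) < 1 := fun k => by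
    simp only [hγs]; rw [div_lt_one (by positivity)]; linarith
  have hstep : ∀ k : ℕ, theta (zdGraph d) 0 (GhostField.prm p) * Real.exp (-(K * J)) ≤
      1 - clusterGF (zdGraph d) (0 : Site d) (GhostField.prm q) (1 - γs k) := by
    intro k
    have h := log_magnetization_sub_le (d := d) (γs k) (hγ0 k) (hγ1 k) hq hqp hp
    set Mp := 1 - clusterGF (zdGraph d) (0 : Site d) (GhostField.prm p) (1 - γs k)
    set Mq := 1 - clusterGF (zdGraph d) (0 : Site d) (GhostField.prm q) (1 - γs k)
    have hMq : 0 < Mq := (hγ0 k).trans_le (gamma_le_one_sub_clusterGF (GhostField.prm q) (hγ0 k).le (hγ1 k).le)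
    have hMpθ : theta (zdGraph d) 0 (GhostField.prm p) ≤ Mp := by
      rw [le_sub_comm]
      exact clusterGF_le_one_sub_theta (GhostField.prm p) (by linarith [hγ1 k]) (by linarith [hγ0 k])
    have hI : ∫ r in q..p, ∑' S : Finset (Site d), ((S.card : ℝ) * (1 - ((γs k : unitInterval) : ℝ)) ^ S.card) *
        (bondPercolation (zdGraph d) (GhostField.prm r)).real (clusterIs 0 S) ≤ J := by
      have h1 := ofReal_integral_chiGamma_le_lintegral (d := d) (γs k) (hγ0 k) (hγ1 k).le hqp
      exact (ENNReal.ofReal_le_iff_le_toReal htop).1 h1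
    have h2 : Real.log Mp - Real.log Mq ≤ K * J := h.trans (mul_le_mul_of_nonneg_left hI hK0.le)
    have h3 : Real.log (theta (zdGraph d) 0 (GhostField.prm p)) - K * J ≤ Real.log Mq := by
      have := Real.log_le_log hθp hMpθ
      linarith
    calc theta (zdGraph d) 0 (GhostField.prm p) * Real.exp (-(K * J))
        = Real.exp (Real.log (theta (zdGraph d) 0 (GhostField.prm p)) - K * J) := by
          rw [Real.exp_sub, Real.exp_log hθp, Real.exp_neg, div_eq_mul_inv]
      _ ≤ Real.exp (Real.log Mq) := Real.exp_le_exp.2 h3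
      _ = Mq := Real.exp_log hMq
  have hlim : Tendsto (fun k : ℕ => 1 - clusterGF (zdGraph d) (0 : Site d) (GhostField.prm q) (1 - γs k)) atTop
      (𝓝 (theta (zdGraph d) 0 (GhostField.prm q))) := by
    have := (tendsto_const_nhds (x := (1 : ℝ))).sub (tendsto_clusterGF_seq (d := d) (GhostField.prm q))
    rw [sub_sub_cancel] at this
    simpa [hγs] using this
  have hge : theta (zdGraph d) 0 (GhostField.prm p) * Real.exp (-(K * J)) ≤ theta (zdGraph d) 0 (GhostField.prm q) :=
    ge_of_tendsto' hlim hstep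
  -- so `log(θp/θq) ≤ K J`
  have h4 : Real.log (theta (zdGraph d) 0 (GhostField.prm p) / theta (zdGraph d) 0 (GhostField.prm q)) ≤ K * J := by
    rw [Real.log_div hθp.ne' hθq.ne']
    have h5 := Real.log_le_log (mul_pos hθp (Real.exp_pos _)) hge
    rw [Real.log_mul hθp.ne' (Real.exp_pos _).ne', Real.log_exp] at h5
    linarith
  calc (1 - p) / (2 * d) * Real.log (theta (zdGraph d) 0 (GhostField.prm p) / theta (zdGraph d) 0 (GhostField.prm q))
      ≤ (1 - p) / (2 * d) * (K * J) := mul_le_mul_of_nonneg_left h4 (div_nonneg (by linarith) (by positivity))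
    _ = J := by
        have h1p : (1 : ℝ) - p ≠ 0 := by linarith
        rw [hK]; field_simp

/-- **Upper bound on the growth of `θ`** (the two-sided companion of the mean-field lower bound): for `0 < q ≤ p < 1` with `θ(q) > 0`,
`θ(p) ≤ θ(q) · exp((2d/(1-p)) ∫_q^p χ^f(r) dr)` whenever the integral is finite — `log θ` grows over `[q,p]` at most like the
integrated finite-cluster susceptibility.  (Rearrangement of `lintegral_chiF_ge_log`.) -/
theorem theta_le_theta_mul_exp_lintegral (hd : 1 ≤ d) {q p : ℝ} (hq : 0 < q) (hqp : q ≤ p) (hp : p < 1)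
    (hθq : 0 < theta (zdGraph d) 0 (GhostField.prm q))
    (hJ : ∫⁻ r in Set.Ioc q p, meanClusterSize (zdGraph d) (0 : Site d) (GhostField.prm r) ≠ ⊤) :
    theta (zdGraph d) 0 (GhostField.prm p) ≤ theta (zdGraph d) 0 (GhostField.prm q) *
      Real.exp ((2 * d / (1 - p)) * (∫⁻ r in Set.Ioc q p, meanClusterSize (zdGraph d) (0 : Site d) (GhostField.prm r)).toReal) := by
  have hd0 : (0 : ℝ) < d := by exact_mod_cast hd
  have hθp : 0 < theta (zdGraph d) 0 (GhostField.prm p) :=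
    hθq.trans_le (theta_mono_holds (zdGraph d) 0 (Set.monotone_projIcc _ hqp))
  set J := (∫⁻ r in Set.Ioc q p, meanClusterSize (zdGraph d) (0 : Site d) (GhostField.prm r)).toReal with hJdef
  have h1 := (ENNReal.ofReal_le_iff_le_toReal hJ).1 (lintegral_chiF_ge_log hd hq hqp hp hθq)
  have h2 : Real.log (theta (zdGraph d) 0 (GhostField.prm p) / theta (zdGraph d) 0 (GhostField.prm q)) ≤ 2 * d / (1 - p) * J := by
    have h1p : (0 : ℝ) < 1 - p := by linarith
    have h3 : (1 - p) / (2 * d) * Real.log (theta (zdGraph d) 0 (GhostField.prm p) / theta (zdGraph d) 0 (GhostField.prm q)) ≤ J := h1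
    rw [div_mul_eq_mul_div, div_le_iff₀ (by positivity)] at h3
    rw [div_mul_eq_mul_div, le_div_iff₀ h1p]
    linarith
  have h4 := Real.exp_le_exp.2 h2
  rw [Real.exp_log (div_pos hθp hθq), div_le_iff₀ hθq] at h4
  linarith [h4]

end Gronwall

end ChiF

namespace ChiF

/-! ### §13. The integrated susceptibility near `p_c`: explicit divergence from a (T2) modulus; the triangle-condition row -/

section GronwallCorollaries

variable {d : ℕ}

/-- **A (T2) modulus gives an explicit lower bound on `∫_q^p χ^f`**: if `θ(r) ≤ ω(r - p_c)` for `r ≥ p_c`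
(`Quant.ThetaModulusNearCritical d ω`) then for `p_c < q ≤ p < 1`:
`∫_q^p χ^f(r) dr ≥ ((1-p)/(2d)) · log((p - p_c)/ω(q - p_c))` (mean-field bound `θ(p) ≥ p - p_c` in the numerator).  As `q ↓ p_c` the right
side tends to `∞` like `log(1/ω(q - p_c))`; with the lane's explicit modulus this is an explicit function (iterated-logarithm class) and
nothing more.  builds on p205010 (kernel theorem, internal audit signed; external expert review pending). -/
theorem lintegral_chiF_ge_log_of_thetaModulusNearCritical (hd : 2 ≤ d) {ω : ℝ → ℝ} (hω : Quant.ThetaModulusNearCritical d ω)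
    {q p : ℝ} (hqc : (criticalProbI d : ℝ) < q) (hqp : q ≤ p) (hp : p < 1) :
    ENNReal.ofReal ((1 - p) / (2 * d) * Real.log ((p - criticalProbI d) / ω (q - criticalProbI d))) ≤
      ∫⁻ r in Set.Ioc q p, meanClusterSize (zdGraph d) (0 : Site d) (GhostField.prm r) := by
  have hpc0 : 0 < (criticalProbI d : ℝ) := by rw [coe_criticalProbI]; exact criticalProb_zd_pos d (by omega)
  have hprm : ∀ {r : ℝ}, 0 ≤ r → r ≤ 1 → ((GhostField.prm r : unitInterval) : ℝ) = r := fun h0 h1 => by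
    simp [GhostField.prm, Set.projIcc_of_mem _ ⟨h0, h1⟩]
  have hq0 : 0 < q := hpc0.trans hqc
  have hq' : ((GhostField.prm q : unitInterval) : ℝ) = q := hprm hq0.le (hqp.trans hp.le)
  have hp' : ((GhostField.prm p : unitInterval) : ℝ) = p := hprm (hq0.le.trans hqp) hp.le
  have hθq : 0 < theta (zdGraph d) 0 (GhostField.prm q) :=
    theta_pos_of_criticalProb_lt_holds (zdGraph d) 0 (GhostField.prm q) (by rw [← coe_criticalProbI, hq']; exact hqc)
  refine (ENNReal.ofReal_le_ofReal ?_).trans (lintegral_chiF_ge_log (by omega) hq0 hqp hp hθq)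
  have hd1 : 1 ≤ d := by omega
  have hd0 : (0 : ℝ) < d := by exact_mod_cast hd1
  refine mul_le_mul_of_nonneg_left ?_ (div_nonneg (by linarith) (by positivity))
  have hθp : p - criticalProbI d ≤ theta (zdGraph d) 0 (GhostField.prm p) := by
    have := ThetaModulus.sub_criticalProbI_le_theta hd (GhostField.prm p) (by rw [hp']; linarith)
    rwa [hp'] at this
  have hωq : theta (zdGraph d) 0 (GhostField.prm q) ≤ ω (q - criticalProbI d) := by
    have := hω.2 (GhostField.prm q) (by rw [hq']; exact hqc.le)
    rwa [hq'] at this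
  have hpc' : 0 < p - criticalProbI d := by linarith
  have hω0 : 0 < ω (q - criticalProbI d) := hθq.trans_le hωq
  exact Real.log_le_log (div_pos hpc' hω0) (by
    rw [div_le_div_iff₀ hω0 hθq]
    exact mul_le_mul hθp hωq hθq.le (hpc'.le.trans hθp))

/-- **Triangle-condition dimensions: logarithmic divergence of the integrated susceptibility** (the rate matching `γ' = 1`):
under `TriangleCondition d` there is `C > 0` with `∫_q^p χ^f(r) dr ≥ ((1-p)/(2d)) · log((p - p_c)/(C (q - p_c)))` for all
`p_c < q ≤ p < 1`.  (Tree: `β = 1` bounded-ratio under the triangle condition, `Quant.thetaHolderNearCritical_one_of_triangle`.) -/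
theorem lintegral_chiF_ge_log_of_triangle (hd : 2 ≤ d) (hT : TriangleCondition d) :
    ∃ C : ℝ, 0 < C ∧ ∀ q p : ℝ, (criticalProbI d : ℝ) < q → q ≤ p → p < 1 →
      ENNReal.ofReal ((1 - p) / (2 * d) * Real.log ((p - criticalProbI d) / (C * (q - criticalProbI d)))) ≤
        ∫⁻ r in Set.Ioc q p, meanClusterSize (zdGraph d) (0 : Site d) (GhostField.prm r) := by
  obtain ⟨C, hC, hH⟩ := Quant.thetaHolderNearCritical_one_of_triangle hd hT
  refine ⟨C, hC, fun q p hqc hqp hp => ?_⟩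
  have hω : Quant.ThetaModulusNearCritical d (fun t => C * t) := by
    refine ⟨?_, fun r hr => ?_⟩
    · have : Tendsto (fun t : ℝ => C * t) (𝓝 0) (𝓝 (C * 0)) := tendsto_const_nhds.mul tendsto_id
      rw [mul_zero] at this
      exact this.mono_left nhdsWithin_le_nhds
    · have := hH r hr
      rwa [Real.rpow_one] at this
  exact lintegral_chiF_ge_log_of_thetaModulusNearCritical hd hω hqc hqp hp

end GronwallCorollaries

end ChiF

end Summit.CriticalPhenomena.PercolationContinuityZ3.Theorems
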